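import Summits.Langlands.Langlands.Theses.ExteriorSquareAscent
import Summits.Langlands.Langlands.Theorems.IrreducibilityBySelfDualityIrreducibleOffSectorOfReciprocity
import Literature.NumberTheory.Automorphic.ChebotarevArtinRepHolds
import Literature.NumberTheory.GaloisRepresentations.FramedRepEquivConj
import HarnessLib

/-!
# Skeleton for crux stmt-Langlands-18056 `ExteriorSquareAscent.RestOfReciprocity` — line `birth`, rev 3
# (by-name leaves: R (stmt-Langlands-17925) ∧ route items `PairLBoundaryJS` (stmt-Langlands-13622) ∧ `PairLPoleJS` (stmt-Langlands-19093))

Lead prover-line-stmt-Langlands-18056-0 (rev 2, 2026-08-17T11:47Z); continuation lead prover-line-stmt-Langlands-18056-c1-0 (rev 3,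
2026-08-17T12:55Z, installing the route-choice planner's request, unit rchoice-Summits-Langlands-Langlands-Cr-ef58f511, evidence
`line-birth-rev3.lean` 12:32Z).  Route `route-Langlands-ExteriorSquareAscent` (rev 2; deciding theorem
`closes : InducedSquareAscent → ReducibleInducesSquare → SelfTwistedIrreducible → RestOfReciprocity → Langlands`; since rev 2 the route
also carries the two Jacquet–Shalika inputs as explicit shared cruxes `PairLPoleJS` (r6, stmt-Langlands-19093) and `PairLBoundaryJS`
(r7, stmt-Langlands-13622)).

## rev 3 versus rev 2 (the only change)

The two analytic stubs are now typed BY NAME as this route's own items — `stub_pairLBoundaryJS : ExteriorSquareAscent.PairLBoundaryJS`,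
`stub_pairLPoleJS : ExteriorSquareAscent.PairLPoleJS` — instead of the Literature named facts
`JacquetShalika1981_partialPairL_{boundary,pole}_repData`; the two are the SAME text (`pairLBoundaryJS_iff` / `pairLPoleJS_iff` below,
both `Iff.rfl`), and `RestOfReciprocity_of` feeds the isobaric bootstrap through these bridges.  Effect: each stub is verbatim an ITEM of
this route (the gate's audit reads them as proof-of-item of `PairLBoundaryJS` / `PairLPoleJS`), so the day stmt-13622 / stmt-19093 close
on ANY of their routes the `_holds` links discharge the stubs by name.  Everything else is rev 2 verbatim.

  `RestOfReciprocity := IrreducibleGL4 → _root_.Langlands`      (the route's D-0027 frame item, "the rest of the mountain").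

## Why the reshape (rev 1 = planner-skel `Lines/birth.lean`, 6 stubs N / W / B_w / LGC∀ / Irr(n ≠ 4) / X → Irr(n = 4))

The two irreducibility stubs of rev 1 are not leaves: the landed weak isobaric bootstrap
(`IrreducibleOffSector.isIrreducible_of_reciprocityUpToIrreducibility`, p103935, and its pointwise form
`isIrreducible_of_geometric_of_weakAutomorphyBelow`) derives irreducibility of EVERY `ℓ`-adic `ρ` Satake–Frobenius compatible a.e.
with an L-algebraic cuspidal `π` of `GL_n(𝔸_K)`, in EVERY rank `n ≥ 1`, from weak existence + weak automorphy below `n` +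
Arthur–Clozel (2.2)/(2.3) (Jacquet–Shalika) — all of which any proof of this crux needs anyway (`¬C ↔ X ∧ ¬Langlands`).  Hence
`X = IrreducibleGL4`, an irreducibility statement (rank 4, non-essentially-self-dual sector, semisimple `ρ`, C-normalisation), is
INERT for this crux: it is subsumed by what the other leaves already give, and it cannot shrink them (R below asks for no
irreducibility).  The honest skeleton is the by-name one, exactly as certified for the sibling frame items stmt-Langlands-18275
(`EisensteinGelfandKirillov.SectorComplement`, lead c1) and stmt-Langlands-13643 (`PhantomRMYoshida.PhantomRMJunction`, lead c17):

* `stub_reciprocityUpToIrreducibilityR` — VERBATIM the text of item **stmt-Langlands-17925**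
  `Summit.Langlands.Langlands.Theses.IrreducibilityBySelfDuality.ReciprocityUpToIrreducibilityR` (reciprocity up to irreducibility
  for EVERY pinned reciprocity datum, with the non-vacuity conjunct `Nonempty (ReciprocityData F)`; OPEN PROBLEM — the summit minus
  irreducibility and uniqueness-up-to-conjugacy in clause (A); own crux chain with 8 registered stubs; written out because the decl
  lives in another route's Theses module).  Rev-1 stubs N, W, B_w, LGC∀ are registered leaves of THAT item
  (`SectorComplementSeam.langlands_of_weak_leaves_forall` packages W → B_w → LGC∀ → JS → RD → Langlands).
* `stub_pairLBoundaryJS` — `ExteriorSquareAscent.PairLBoundaryJS` = item **stmt-Langlands-13622** (r7 here; also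
  `AnalyticDescent.PairLBoundaryJS`; `↔ JacquetShalika1981_partialPairL_boundary_repData` by `Iff.rfl`): Arthur–Clozel Ch. 3 (2.2), a
  theorem in print, own analytic lines (crux chain `Cruxes/PairLBoundaryJS`, 3 of 7 stubs landed 2026-08-17).
* `stub_pairLPoleJS` — `ExteriorSquareAscent.PairLPoleJS` = item **stmt-Langlands-19093** (r6 here; also `AnalyticDescent.PairLPoleJS`,
  `MirrorPairReflection.PairLPoleJS`; `↔ JacquetShalika1981_partialPairL_pole_repData` by `Iff.rfl`): Arthur–Clozel Ch. 3 (2.3), a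
  theorem in print, own analytic lines.

`RestOfReciprocity_of` (kernel-checked, no `sorry`, ≈ 35 tactic lines): discard `X`; `Langlands` from R + JS exactly as in the
landed re-typed seam `SectorComplementSeam.langlands_of_reciprocityUpToIrreducibility_forall_text_of_JS` (p147356; re-elaborated
here on structural imports because the farm serves that module unbuilt today): for each `𝓡`, clause (B) is R's; clause (A)'s
avatar — and every a.e.-compatible `ρ'` — is irreducible by the bootstrap `IrreducibleOffSector.isIrreducible_of_reciprocityUpToIrreducibility`
(p103935), hence semisimple; equal Satake parameters a.e. (`hasSatakeParamAt_unique_holds`) give equal Frobenius polynomials a.e.,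
so the two avatars are equivalent (Chebotarev + Brauer–Nesbitt, `FramedGaloisRep.nonempty_equiv_of_hasFrobCharpolyAt_eventually
chebotarev_artinRep_holds`) and conjugate (`FramedRep.exists_eq_conj_of_equiv`).  `X` is visibly unused (`fun _ => …`): that is the
finding, not an oversight — see the item-level certificate `Theorems/ExteriorSquareAscentRestOfReciprocityOfR.lean`
(`Langlands ↔ IrreducibleGL4 ∧ RestOfReciprocity`; under JS, `RestOfReciprocity ↔ (IrreducibleGL4 → R)`).

Outcome this skeleton supports: `blocked-on: stmt-Langlands-17925` (and 13622 / 19093).  No stub is delegable: each is an open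
item with its own seats (status 2026-08-17T12:35Z: all three OPEN; 17925 lead c1-0 with 6 open leaves, 13622 4 open / 3 landed stubs, 19093 unlined).

Disproof used: `Cruxes/RestOfReciprocity/Disproof.lean` (cdisprove cycle 1, 2026-08-17T11:55Z): NO KILL by design (`¬C ↔ X ∧ ¬Langlands`;
§2 containment `Langlands → IrreducibleGL4`); no `-- Targets` on these stubs (they are items); no `Theorems/…/Negative/`.
Negatives index (`ledger negatives --problem Langlands`, 4 entries 16951 / 16822 / 17212 / 3797): none of the shape of a stub.

References: K. Buzzard, T. Gee, LMS LNS 414 (2014), Conj. 3.2.1–3.2.2 [BuzzardGeeLMS2014]; J.-M. Fontaine, B. Mazur (1995), Conj. 1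
[FontaineMazurGeometric1995]; J. Arthur, L. Clozel, Ann. Math. Stud. 120, Ch. 3 §2 (2.2)–(2.3) [ArthurClozelAMS120]; H. Jacquet,
J. Shalika, Amer. J. Math. 103 (1981) I §5, II Thm. 4.4 [JacquetShalikaAJM1981II]; F. Calegari, T. Gee, Ann. Inst. Fourier 63 (2013)
§1.1 [CalegariGee2013]; M. Harris, R. Taylor, Ann. Math. Stud. 151 (2001), Thm. A [HarrisTaylorAMS2001].
-/

noncomputable section

set_option linter.dupNamespace false -- project-wide option; `Summit.Langlands.Langlands` is the mandated namespace

open scoped NumberField Classical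
open Filter IsDedekindDomain
open Literature.NumberTheory.Automorphic Literature.NumberTheory.GaloisRepresentations
open Summit.Langlands
open Summit.Langlands.Langlands.Theses.ExteriorSquareAscent (RestOfReciprocity IrreducibleGL4 PairLBoundaryJS PairLPoleJS)

namespace Summit.Langlands.Langlands.Cruxes.RestOfReciprocity.Birth

/-! ## 0. The crux, by name -/

/-- The crux IS `X → Langlands`, definitionally. [folklore] -/
theorem restOfReciprocity_iff : RestOfReciprocity ↔ (IrreducibleGL4 → _root_.Langlands) :=
  Iff.rfl

/-- For the record (converse direction): the summit gives the crux outright (an `example`, so that no declaration of this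
file concludes the crux except the composition). -/
example (h : _root_.Langlands) : RestOfReciprocity :=
  fun _ => h

/-! ## 1. The three stubs (the ONLY sorries of this file) — each VERBATIM an existing open item -/

/-- **stub R — reciprocity up to irreducibility for every pinned reciprocity datum** = the text of item stmt-Langlands-17925
`IrreducibilityBySelfDuality.ReciprocityUpToIrreducibilityR`, verbatim: for every number field `F`, (i) reciprocity data exist
(`Nonempty (ReciprocityData F)`: a local Langlands datum at every completion pinned to THE canonical Artin maps — Harris–Taylor
2001 Thm. A / Henniart 2000 + local class field theory), and (ii) for EVERY datum `Rec`, every `n ≥ 1`, `hcpt`: (A') every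
L-algebraic cuspidal `π` of `GL_n(𝔸_F)` has, for all `ℓ, ι`, SOME geometric `ρ` corresponding to it at every finite place
(no irreducibility, no uniqueness), and (B) every irreducible geometric `ρ` corresponds to some L-algebraic cuspidal `π`.
OPEN PROBLEM (the summit minus irreducibility/uniqueness in (A)); staffed on its own crux chain.
[cite: BuzzardGeeLMS2014, Conj. 3.2.1 and Conj. 3.2.2] [cite: FontaineMazurGeometric1995, Conj. 1] [cite: HarrisTaylorAMS2001, Thm. A] -/
theorem stub_reciprocityUpToIrreducibilityR : ∀ (F : Type) [Field F] [NumberField F], Nonempty (ReciprocityData F) ∧ ∀ (Rec : ReciprocityData F) (n : ℕ), 0 < n → ∀ hcpt : Literature.NumberTheory.Automorphic.isCompact_glFiniteIntegralLevel n F, (∀ π : Literature.NumberTheory.Automorphic.CuspidalAutomorphicRepData n F hcpt, π.1.IsLAlgebraic → ∀ (ℓ : ℕ) [Fact ℓ.Prime] (ι : PadicAlgCl ℓ ≃+* ℂ), ∃ ρ : Literature.NumberTheory.GaloisRepresentations.FramedGaloisRep F (PadicAlgCl ℓ) n, IsGeometricFramed Rec ρ ∧ Corresponds Rec ι π.1 ρ)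 ∧ GaloisToAutomorphic n Rec hcpt := by
  sorry

/-- **stub JS (2.2) — the Jacquet–Shalika boundary line for partial Rankin–Selberg `L`-functions of cuspidal Borel–Jacquet data**,
BY NAME the route item `ExteriorSquareAscent.PairLBoundaryJS` (= item stmt-Langlands-13622; the same text as
`JacquetShalika1981_partialPairL_boundary_repData`, see `pairLBoundaryJS_iff`): Arthur–Clozel Ch. 3 (2.2) — a THEOREM in print
(Jacquet–Shalika 1981 I §5, II Thm. 4.4 via Shahidi), formalisation debt with its own lines.
[cite: JacquetShalikaAJM1981II, Thm. 4.4] [cite: ArthurClozelAMS120, Ch. 3 §2 (2.2)] -/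
theorem stub_pairLBoundaryJS : PairLBoundaryJS := by
  sorry

/-- **stub JS (2.3) — the pole of the partial Rankin–Selberg `L`-function at `s = 1` detects contragredience**, BY NAME the
route item `ExteriorSquareAscent.PairLPoleJS` (= item stmt-Langlands-19093; the same text as
`JacquetShalika1981_partialPairL_pole_repData`, see `pairLPoleJS_iff`): Arthur–Clozel Ch. 3 (2.3) — a THEOREM in print
(Jacquet–Shalika 1981 II Prop. 3.6 / Thm. 4.4), formalisation debt with its own lines.
[cite: JacquetShalikaAJM1981II, Prop. 3.6] [cite: ArthurClozelAMS120, Ch. 3 §2 (2.3)] -/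
theorem stub_pairLPoleJS : PairLPoleJS := by
  sorry

/-! ### The two analytic stubs ARE the Literature named facts (δ): bridges used by the composition -/

/-- The route item `PairLBoundaryJS` (stmt-Langlands-13622) IS the named fact
`JacquetShalika1981_partialPairL_boundary_repData`, definitionally. [folklore] -/
theorem pairLBoundaryJS_iff :
    PairLBoundaryJS ↔ Literature.NumberTheory.Automorphic.JacquetShalika1981_partialPairL_boundary_repData :=
  Iff.rfl

/-- The route item `PairLPoleJS` (stmt-Langlands-19093) IS the named fact `JacquetShalika1981_partialPairL_pole_repData`,
definitionally. [folklore] -/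
theorem pairLPoleJS_iff :
    PairLPoleJS ↔ Literature.NumberTheory.Automorphic.JacquetShalika1981_partialPairL_pole_repData :=
  Iff.rfl

/-! ## 2. The stub statements as named propositions (hypotheses of the composition, admissible by stub name)

Each `_Goal.stub_x` is `type_of% @stub_x`: literally the stub's statement, no text duplicated, no `sorry` inherited. -/

namespace _Goal

/-- The statement of `stub_reciprocityUpToIrreducibilityR` (literally its type). [folklore] -/
def stub_reciprocityUpToIrreducibilityR : Prop :=
  type_of% @Summit.Langlands.Langlands.Cruxes.RestOfReciprocity.Birth.stub_reciprocityUpToIrreducibilityR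

/-- The statement of `stub_pairLBoundaryJS` (literally its type). [folklore] -/
def stub_pairLBoundaryJS : Prop :=
  type_of% @Summit.Langlands.Langlands.Cruxes.RestOfReciprocity.Birth.stub_pairLBoundaryJS

/-- The statement of `stub_pairLPoleJS` (literally its type). [folklore] -/
def stub_pairLPoleJS : Prop :=
  type_of% @Summit.Langlands.Langlands.Cruxes.RestOfReciprocity.Birth.stub_pairLPoleJS

end _Goal

/-! ## 3. The composition (kernel-checked, no `sorry`): R → PairLBoundaryJS → PairLPoleJS → RestOfReciprocity, `X` discarded -/

/-- **`RestOfReciprocity` from its three by-name leaves.**  Discard the antecedent `X = IrreducibleGL4` (inert: irreducibility in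
clause (A) is free given (A') + (B) + JS by the isobaric bootstrap) and obtain `Langlands` from R + JS (2.2) + JS (2.3) by the landed
re-typed seam `SectorComplementSeam.langlands_of_reciprocityUpToIrreducibility_forall_text_of_JS` (clause (B) is R's; the avatar of
(A') and every a.e.-compatible `ρ'` are irreducible — bootstrap — hence semisimple, with equal Satake parameters a.e., so equal
Frobenius polynomials a.e., so equivalent by Chebotarev + Brauer–Nesbitt, so conjugate).  Hypotheses = the three stub statements by
name; conclusion = the route decl by name.
[cite: BuzzardGeeLMS2014, Conj. 3.2.1 and Conj. 3.2.2] [cite: CalegariGee2013, §1.1] [cite: ArthurClozelAMS120, Ch. 3 §2 (2.2)–(2.3)] -/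
theorem RestOfReciprocity_of (h1 : _Goal.stub_reciprocityUpToIrreducibilityR) (h2 : _Goal.stub_pairLBoundaryJS)
    (h3 : _Goal.stub_pairLPoleJS) : RestOfReciprocity := by
  rw [restOfReciprocity_iff]
  intro _hX F _ _
  dsimp only [_Goal.stub_reciprocityUpToIrreducibilityR, _Goal.stub_pairLBoundaryJS, _Goal.stub_pairLPoleJS] at h1 h2 h3
  refine ⟨(h1 F).1, fun Rec n hn hcpt => ?_⟩
  have hRec := fun n hn hcpt => (h1 F).2 Rec n hn hcpt
  obtain ⟨hA, hB⟩ := (h1 F).2 Rec n hn hcpt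
  refine ⟨?_, hB⟩
  intro π hL ℓ _ ι
  -- irreducibility of EVERY avatar Satake–Frobenius compatible a.e. with `π`: the isobaric bootstrap (R + JS)
  have irr : ∀ ρ : FramedGaloisRep F (PadicAlgCl ℓ) n,
      (∀ᶠ v : HeightOneSpectrum (𝓞 F) in cofinite, SatakeFrobCompatibleAt ι π.1 ρ v) →
        ρ.toGaloisRep.IsIrreducible :=
    fun ρ hρ => Summit.Langlands.Langlands.Theorems.IrreducibleOffSector.isIrreducible_of_reciprocityUpToIrreducibility
      (pairLBoundaryJS_iff.mp h2) (pairLPoleJS_iff.mp h3) hRec hcpt hn π hL ι ρ hρ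
  obtain ⟨ρ, hgeo, hcorr⟩ := hA π hL ℓ ι
  refine ⟨ρ, irr ρ hcorr.1, hgeo, hcorr, fun ρ' hcorr' => ?_⟩
  -- uniqueness up to conjugacy: irreducible ⇒ semisimple; equal Satake parameters a.e. ⇒ equal Frobenius polynomials a.e.
  -- ⇒ equivalent (Chebotarev + Brauer–Nesbitt) ⇒ conjugate
  have hs : ρ.toGaloisRep.IsSemisimple := by
    haveI := irr ρ hcorr.1
    change ComplementedLattice _
    infer_instance
  have hs' : ρ'.toGaloisRep.IsSemisimple := by
    haveI := irr ρ' hcorr'.1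
    change ComplementedLattice _
    infer_instance
  have hev : ∀ᶠ v : HeightOneSpectrum (𝓞 F) in cofinite,
      ρ.IsUnramifiedAt v ∧ ρ'.IsUnramifiedAt v ∧
        ∃ P : Polynomial (PadicAlgCl ℓ), ρ.HasFrobCharpolyAt v P ∧ ρ'.HasFrobCharpolyAt v P := by
    filter_upwards [hcorr.1, hcorr'.1] with v hv hv'
    obtain ⟨α, hα, hur, hcp⟩ := hv
    obtain ⟨α', hα', hur', hcp'⟩ := hv'
    obtain rfl : α = α' := AutomorphicRepData.hasSatakeParamAt_unique_holds π.1 hα hα'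
    exact ⟨hur, hur', _, hcp, hcp'⟩
  obtain ⟨e⟩ := FramedGaloisRep.nonempty_equiv_of_hasFrobCharpolyAt_eventually
    chebotarev_artinRep_holds ρ ρ' hs hs' hev
  obtain ⟨P, hP⟩ := FramedRep.exists_eq_conj_of_equiv ρ ρ' e
  exact ⟨P, hP.symm⟩

/-- By-name sanity check (an `example`, not a declaration): the three stubs feed the composition as they stand. -/
example : RestOfReciprocity :=
  RestOfReciprocity_of stub_reciprocityUpToIrreducibilityR stub_pairLBoundaryJS stub_pairLPoleJS

end Summit.Langlands.Langlands.Cruxes.RestOfReciprocity.Birth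

end
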